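import Literature.MathematicalPhysics.QuantumFieldTheory.Balaban1983to89.B9Eq386GreenkLipschitzEnergyDiagonal
import Literature.MathematicalPhysics.QuantumFieldTheory.Balaban1983to89.B7Eq43AveragedSmallnessLinearFeed
import Literature.MathematicalPhysics.QuantumFieldTheory.Balaban1983to89.B9Eq325RLipschitzSqrtTowerPackaged

/-!
# `Balaban1983to89.B9Eq386GreenkLipschitzEnergyTwoWindows` — T. Bałaban, *Propagators for lattice gauge theories in a background field*, Commun. Math. Phys.
# **99** (1985) 389–434 [Balaban1985BackgroundPropagators] Thm 3.4 p. 400 ∕ (3.84)–(3.86) p. 407 with (3.25) p. 394, Thm 3.11 p. 416 and (3.35)–(3.37) p. 396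
# AT `k = n+1` AVERAGING LEVELS ON PRINT's DIAGONAL `ηL^{n+1} = 1`: **THE `k`-TH-STEP GREEN's FUNCTION IS LIPSCHITZ IN THE BACKGROUND AT THE FLAT POINT IN
# THE ENERGY NORM ON PRINT's CLASS (3.35) — NO OPERATOR LETTER, NO PROFILE BINDER** — the row OWNER's
# `B9Eq386GreenkLipschitzEnergyDiagonal.exists_norm_G1k_sub_flat_le_diagonal_closed` (g86 INTENT-4b) with `εU ∕ hεU ∕ hUε ∕ hεg ∕ r ∕ hUb ∕ hR ∕ C_R` STRUCK:
# the profile fed α-LINEARLY from the two windows (`B7Eq43AveragedSmallnessLinearFeed`), the `R`-letter from the package (`B9Eq325RLipschitzSqrtTowerPackaged`)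

statement-level skeleton of published theorems with citation tags; proofs where landed; nothing here is a claim about the Yang–Mills mass gap

CITATION HEADER (lean-in-tree rule).  Audit cell `pub-balaban`, sub-cell `t4`, BINDER row NE9; filed by NE9 formalisation-swarm leaf prover 03
(`b2b-balaban-t4-ne9-formalise-leaf-03`, gen 66), INTENT I-ne9leaf03-g66-D.  Sources READ in the held text `paper:balaban1985-cmp99-background-propagators`
pp. 394, 396, 400, 403, 407, 416.  Objects BY NAME: the owner's `laplaceAk`, `greenK`; `covCurlL2K`, `covDivL2K`; nothing re-declared, 0 `def`.
RELATION TO ne9-leaf-04's staged `B9Eq386GreenLipschitzEnergyClosed` (gen 76, unfiled at this writing): that file is the `r`-GENERAL letter-free version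
(profile `ε_j ≤ αr^j` displayed, `C_R` inhabited inline) — a different statement; this file is built on the OWNER's 4b + this lineage's feed + the package
directly and copies none of its arithmetic.

THE PRINT (verbatim).  p. 400, Thm 3.4: *«There exists a positive constant α₁ such that the operators G′(U), (Q′(U)G′²(U)Q′*(U))⁻¹, R(U), G(U) extend to
configurations U′U for α ≤ α₁ as analytic functions of A … describing these analytic extensions as small perturbations of the operators depending on U
only.»*; p. 407 (3.86): *«G(U′U) = G(U)(I − V(A)G(U))⁻¹»*; p. 396 (3.35): bonds `αη`, plaquettes `αη²`.

WHAT IS PROVED (sorry-free; proof lane — 0 `def`; [folklore] binder plumbing over landed files).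
* **`exists_norm_G1k_sub_flat_le_twoWindows`** — `∃ α₀ C > 0` (closed in `(d, a, L, M_φ, M_φ′, C_τ, ρ_w)`; `C = K·C^{4b}(C_R, r = 1∕L)`) BEFORE `∀ n η
  (ηL^{n+1} = 1) c₀ c₁ (c₀(L^{n+1})^d = c₁) (|η|^d∕c₀ ≤ ρ_w) m U (E162's data) S (AvgClosed) (U(b) ∈ S) α (0 ≤ α ≤ α₀) hRS (‖U(b) − 1‖ ≤ αη) (‖U(∂p) − 1‖ ≤ αη²)`,
  ANY positivity witnesses `hposU`, `hpos1`, every `y`: `‖G_k(U)y − G_k(1)y‖ ≤ Cα‖y‖ ∧ ‖curl₁(G_k(U)y − G_k(1)y)‖ ≤ Cα‖y‖ ∧ ‖div₁(G_k(U)y − G_k(1)y)‖ ≤ Cα‖y‖`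
  — the Green's-function Lipschitz letter of the chart (`Support/NE9CurChartLipschitzAtFlat`'s shape) on print's class with no operator letter at all.
HONEST SCOPE.  [folklore]; FIRST order at the flat point on the diagonal ONLY (not two general backgrounds, not analyticity, not (3.86)'s series); the `L²`∕energy
clause — no kernel bound, no decay, NOT the (N)-reading; the two WINDOWS, E162's data, `hRS`, `C_τ`, `ρ_w` and the two positivity witnesses stay HYPOTHESES
(the witnesses are theorems on the class: `B9Thm311TowerGaugeOrbitTwoWindows`); «NE9 ⇐ the named binders»; NE9 NOT PRINTED ∕ NOT PROVED; NOT summit progress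
(cell pub-balaban: row NE9 WALLED ON A MODEL (O-NE9-1; #5 UNRULED); spine PROVED 0/9; rung (B)+1 finite T⁴ — NOT infinite volume, NOT mass gap, NOT BetaPertH, NOT
Clay; HONEST DEPENDENCY: continuum YM on T⁴ ⇐ BetaPertH ∧ nine spine estimates (0/9 proved); BetaPertH ⇐ (D1) ∧ (D4) ∧ CAP+tail; G-an2-4 gates asym, D1 and
NE2/3/4).  NEW file; nothing modified.  Net new unproved facts: 0.
-/

noncomputable section

open scoped InnerProductSpace ComplexConjugate BigOperators

namespace Literature.MathematicalPhysics.QuantumFieldTheory.Balaban1983to89.B9Eq386GreenkLipschitzEnergyTwoWindows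

open B4Sect5Torus (TSite)
open B9SectCLatticeCarrier (Bond)
open B11Eq103H1Complex (BondL2K covDivL2K greenK)
open B9Eq310HessianOperator (adTransportW covCurlL2K)
open B9Eq310DeltaPrime (plaqHolU)
open B9Eq315QTorus (perCfg cornerSite)
open B9Eq315QTower (towerP UlevOf)
open B9Eq315QTowerFlat (perCfg_UlevOf_one_mem_U1 norm_Wcx_UlevOf_one_sub_one_le)
open B9Eq326OperatorTower (laplaceAk)
open B7Prop1Explicit (U1 Wcx boxVec)
open B7Prop2Explicit (AvgClosed)
open B9Eq386GreenkLipschitzEnergyDiagonal (exists_norm_G1k_sub_flat_le_diagonal_closed)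
open B7Eq43AveragedSmallnessLinearFeed (twoWindows_linear_feed)
open B9Eq325RLipschitzSqrtTowerPackaged (exists_norm_RofUk_sub_RofUk_one_le_diagonal)

variable {d : ℕ} (L : ℕ) [NeZero L] (hL : 1 ≤ L) (hL2 : 2 ≤ L)
  {𝔸 : Type*} [NormedRing 𝔸] [NormedAlgebra ℂ 𝔸] [CompleteSpace 𝔸] [NormOneClass 𝔸] [StarRing 𝔸] [NormedStarGroup 𝔸] [StarModule ℂ 𝔸]
  {W : Type*} [NormedAddCommGroup W] [InnerProductSpace ℂ W] [FiniteDimensional ℂ W] (φ : W ≃ₗ[ℂ] 𝔸)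
  {Mφ Mφ' : ℝ} (hMφ : 0 ≤ Mφ) (hMφ' : 0 ≤ Mφ') (hφ : ∀ w, ‖φ w‖ ≤ Mφ * ‖w‖) (hφ' : ∀ X, ‖φ.symm X‖ ≤ Mφ' * ‖X‖)
  {a : ℝ} (ha : 0 < a) (τ : 𝔸 →ₗ[ℂ] ℂ) {Cτ : ℝ} (hτ : ∀ X, ‖τ X‖ ≤ Cτ * ‖X‖) (hCτ : 0 ≤ Cτ) {ρw : ℝ} (hρw : 0 ≤ ρw)

include hL2 hMφ hMφ' hφ hφ' ha hτ hCτ hρw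

/-- **THE `k`-TH-STEP GREEN's FUNCTION IS LIPSCHITZ IN THE BACKGROUND AT THE FLAT POINT IN THE ENERGY NORM ON PRINT's CLASS (3.35) — NO OPERATOR LETTER, NO
PROFILE BINDER**: there are `α₀, C > 0` (closed in `(d, a, L, M_φ, M_φ′, C_τ, ρ_w)`) such that for every `n`, `η` (`ηL^{n+1} = 1`), `c₀, c₁` (`c₀(L^{n+1})^d = c₁`,
`|η|^d∕c₀ ≤ ρ_w`), `m`, background `U` of E162's data valued in an averaging-closed `S`, `0 ≤ α ≤ α₀`, `hRS`, the two windows `‖U(b) − 1‖ ≤ αη`,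
`‖U(∂p) − 1‖ ≤ αη²`, ANY positivity witnesses of `Δ^{(n+1)}_a(U)` and of the flat `Δ^{(n+1)}_a(1)`, and every `y`: `‖G_k(U)y − G_k(1)y‖ ≤ Cα‖y‖`,
`‖curl₁(G_k(U)y − G_k(1)y)‖ ≤ Cα‖y‖`, `‖div₁(G_k(U)y − G_k(1)y)‖ ≤ Cα‖y‖` — the OWNER's `exists_norm_G1k_sub_flat_le_diagonal_closed` at `r = 1∕L`, `C_R` := the
packaged `R`-letter's, fed at `β = Kα` by `twoWindows_linear_feed`. [cite: Balaban1985BackgroundPropagators, Thm 3.4 p.400, (3.84)–(3.86) p.407, (3.25) p.394, (3.35)–(3.37) p.396, p.403, Thm 3.11 p.416; Balaban1985Averaging, Prop. 2 (52)–(54) p.26] -/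
theorem exists_norm_G1k_sub_flat_le_twoWindows :
    ∃ α₀ C : ℝ, 0 < α₀ ∧ 0 < C ∧ ∀ (n : ℕ) (η : ℝ), η * (L : ℝ) ^ (n + 1) = 1 →
      ∀ (c₀ c₁ : ℝ) [Fact (0 < c₀)] [Fact (0 < c₁)], c₀ * ((L : ℝ) ^ (n + 1)) ^ d = c₁ → |η| ^ d / c₀ ≤ ρw →
      ∀ (m : Fin d → ℕ) [∀ i, NeZero (m i)] (U : Bond d (towerP L m (n + 1)) → 𝔸ˣ) (αU : ℕ → ℝ) (hα1 : ∀ j, αU j ≤ 1 / 64)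
        (hU1 : ∀ (j : ℕ) (x : B7Prop1Explicit.Site d) (κ : Fin d), perCfg (towerP L m (j + 1)) (UlevOf L m (n + 1) U j) x κ ∈ U1 𝔸)
        (hreg : ∀ (j : ℕ) (y : TSite d (towerP L m j)) (κ : Fin d) (r : Fin d → Fin L),
          ‖((Wcx L (perCfg (towerP L m (j + 1)) (UlevOf L m (n + 1) U j)) (cornerSite L y) κ (boxVec L r) : 𝔸ˣ) : 𝔸) - 1‖ ≤ αU j)
        {S : Subgroup 𝔸ˣ}, AvgClosed d L S → (∀ b, U b ∈ S) →
      ∀ {α : ℝ}, 0 ≤ α → α ≤ α₀ →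
        (∀ (b : Bond d (towerP L m (n + 1))) (v u : W), ⟪adTransportW φ U b v, u⟫_ℂ = ⟪v, adTransportW φ (fun b => (U b)⁻¹) b u⟫_ℂ) →
        (∀ b, ‖(U b : 𝔸) - 1‖ ≤ α * η) →
        (∀ p : B9SectCLatticeCarrier.Plaq d (towerP L m (n + 1)), ‖(plaqHolU U p : 𝔸) - 1‖ ≤ α * η ^ 2) →
        ∀ (hposU : ∀ x : BondL2K ℂ d (towerP L m (n + 1)) c₀ W, x ≠ 0 →
            0 < RCLike.re ⟪x, laplaceAk L m n φ η U hL αU hα1 hU1 hreg τ (c₀ := c₀) (c₁ := c₁) a x⟫_ℂ)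
          (hpos1 : ∀ x : BondL2K ℂ d (towerP L m (n + 1)) c₀ W, x ≠ 0 →
            0 < RCLike.re ⟪x, laplaceAk L m n φ η (fun _ : Bond d (towerP L m (n + 1)) => (1 : 𝔸ˣ)) hL (fun _ => 0) (fun _ => by norm_num)
              (perCfg_UlevOf_one_mem_U1 L m (n + 1)) (norm_Wcx_UlevOf_one_sub_one_le L m (n + 1) (fun _ => 0) (fun _ => le_rfl)) τ
              (c₀ := c₀) (c₁ := c₁) a x⟫_ℂ)
          (y : BondL2K ℂ d (towerP L m (n + 1)) c₀ W),
          ‖greenK (laplaceAk L m n φ η U hL αU hα1 hU1 hreg τ (c₀ := c₀) (c₁ := c₁) a) hposU y -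
            greenK (laplaceAk L m n φ η (fun _ : Bond d (towerP L m (n + 1)) => (1 : 𝔸ˣ)) hL (fun _ => 0) (fun _ => by norm_num)
              (perCfg_UlevOf_one_mem_U1 L m (n + 1)) (norm_Wcx_UlevOf_one_sub_one_le L m (n + 1) (fun _ => 0) (fun _ => le_rfl)) τ
              (c₀ := c₀) (c₁ := c₁) a) hpos1 y‖ ≤ C * α * ‖y‖ ∧
          ‖covCurlL2K ℂ c₀ ((η : ℂ))⁻¹ (adTransportW φ (fun _ : Bond d (towerP L m (n + 1)) => (1 : 𝔸ˣ)))
            (greenK (laplaceAk L m n φ η U hL αU hα1 hU1 hreg τ (c₀ := c₀) (c₁ := c₁) a) hposU y -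
            greenK (laplaceAk L m n φ η (fun _ : Bond d (towerP L m (n + 1)) => (1 : 𝔸ˣ)) hL (fun _ => 0) (fun _ => by norm_num)
              (perCfg_UlevOf_one_mem_U1 L m (n + 1)) (norm_Wcx_UlevOf_one_sub_one_le L m (n + 1) (fun _ => 0) (fun _ => le_rfl)) τ
              (c₀ := c₀) (c₁ := c₁) a) hpos1 y)‖ ≤ C * α * ‖y‖ ∧
          ‖covDivL2K ℂ c₀ ((η : ℂ))⁻¹ (adTransportW φ fun _ : Bond d (towerP L m (n + 1)) => (1 : 𝔸ˣ)⁻¹)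
            (greenK (laplaceAk L m n φ η U hL αU hα1 hU1 hreg τ (c₀ := c₀) (c₁ := c₁) a) hposU y -
            greenK (laplaceAk L m n φ η (fun _ : Bond d (towerP L m (n + 1)) => (1 : 𝔸ˣ)) hL (fun _ => 0) (fun _ => by norm_num)
              (perCfg_UlevOf_one_mem_U1 L m (n + 1)) (norm_Wcx_UlevOf_one_sub_one_le L m (n + 1) (fun _ => 0) (fun _ => le_rfl)) τ
              (c₀ := c₀) (c₁ := c₁) a) hpos1 y)‖ ≤ C * α * ‖y‖ := by
  have hL0 : (0 : ℝ) < L := by exact_mod_cast lt_of_lt_of_le (by norm_num) hL2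
  have hr0 : (0 : ℝ) ≤ 1 / (L : ℝ) := by positivity
  have hr1 : 1 / (L : ℝ) < 1 := by rw [div_lt_one hL0]; exact_mod_cast lt_of_lt_of_le (by norm_num) hL2
  -- the packaged `R`-letter and the OWNER's `∃`, opened once at its constant
  obtain ⟨αR, CR, hαR, hCR, HR⟩ := exists_norm_RofUk_sub_RofUk_one_le_diagonal L φ hMφ hMφ' hφ hφ' hr0 hr1
  obtain ⟨α₁, C, hα₁, hC, H⟩ := exists_norm_G1k_sub_flat_le_diagonal_closed L hL φ hMφ hMφ' hφ hφ' ha hr0 hr1 τ hτ hCτ hρw hCR.le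
  -- the α-linear feed below both thresholds
  obtain ⟨T, hT, F⟩ := twoWindows_linear_feed L hL2 (d := d) (𝔸 := 𝔸) (lt_min hα₁ hαR)
  refine ⟨T, C * (1 + 512 * (d + 1) * (d + 4)), hT, by positivity, ?_⟩
  intro n η hηL c₀ c₁ _ _ hw hρ m _ U αU hα1 hU1 hreg S hS hU α hα0 hαle hRS hUη hpl hposU hpos1 y
  obtain ⟨hβ0, hβ1, hUb, hUη', hpl', hLb, εU, hεU, hUε, hεg⟩ := F m n hS hU hηL hα0 hαle hUη hpl
  have hR := HR n η hηL c₀ c₁ hw m U εU hεU hUε hLb hβ0 (hβ1.trans (min_le_right _ _)) hRS hUb hUη' hεg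
  obtain ⟨h1, h2, h3⟩ :=
    H n η hηL c₀ c₁ hw hρ m U αU hα1 hU1 hreg εU hεU hUε hβ0 (hβ1.trans (min_le_left _ _)) hRS hUb hUη' hpl' hεg hR hposU hpos1 y
  exact ⟨h1.trans_eq (by ring), h2.trans_eq (by ring), h3.trans_eq (by ring)⟩

end Literature.MathematicalPhysics.QuantumFieldTheory.Balaban1983to89.B9Eq386GreenkLipschitzEnergyTwoWindows

end
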